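/-
Copyright (c) 2026. All rights reserved.
Released under Apache 2.0 license as described in the file LICENSE.
Authors: abc-iut cell, prover seat abc-iut-w5-d138 (wave 5, gen 8).
-/
import Literature.IUT.LogVolume.UnitLogDepthThreeCongruences
import Literature.NumberTheory.EllipticCurves.PAdicHeightsProofs
import HarnessLib

/-!
# Two successive `p`-adic logarithms of units at `e = p`, `f = 1` (`p` odd), II: the DICHOTOMY

Proof-only sequel (theorems, no definitions) of `UnitLogDepthThreeCongruences.lean` (same elementary setting:
`K` a complete ultrametric normed `ℚ_p`-algebra field, `‖π‖ᵖ = p⁻¹`, GAP `‖x‖ < 1 ⇒ ‖x‖ ≤ ‖π‖` (`e = p`),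
FROBENIUS `‖t‖ ≤ 1 ⇒ ‖tᵖ − t‖ < 1` (`f = 1`); `w := πᵖ/p + π`, `c := (p − 1)⁻¹`; for a unit `u`,
`u^{p−1} = 1 + πt`).  From the key congruence `log_p u ≡ c·tᵖ·w (mod π²)` and the tree's `1`-Lipschitz
estimate `‖aⁿ − bⁿ‖ ≤ ‖a − b‖` on the unit disc (`Literature.NumberTheory.EllipticCurves.norm_pow_sub_pow_le`):

* `norm_pow_unitLog_sub_pow_le_sq` — for `‖t‖ = 1` (every unit with a unit logarithm):
  **`(log_p u)^{p−1} ≡ w^{p−1} (mod π²)`** (`c ≡ −1 (mod p)`, `p − 1` even, `(t^{p−1})ᵖ ≡ 1 (mod π²)`);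
* **CASE (a)** `‖w^{p−1} − 1‖ ≤ ‖π‖²` (`w` congruent to a Teichmüller representative mod `π²`;
  `caseA_of_norm_sub_natCast_le`; e.g. `πᵖ = p(1 − π)`, a root of the Eisenstein polynomial `Xᵖ + pX − p`,
  where `w = 1`: `caseA_of_pow_eq`): **`norm_unitLog_unitLog_lt_one`** — for EVERY unit `u` with
  `‖log_p u‖ = 1` one has `‖log_p(log_p u)‖ < 1`: NO unit survives two logarithms
  (`setOf_two_steps_eq_empty`), although depth `2` is inhabited (`norm_unitLog_one_add_pi_eq_one`);
* **CASE (b)** `‖w^{p−1} − 1‖ > ‖π‖²` (e.g. `πᵖ = p`, `w = 1 + π`: `caseB_of_pow_eq`):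
  **`norm_pow_unitLog_sub_one_eq`** — `{u ∈ 𝒪_K^× : ‖u^{p−1} − 1‖ = ‖π‖}` is mapped into itself by `log_p`, so
  each of its elements (e.g. `1 + π`) has ALL its iterated logarithms of norm `1`
  (`norm_iterate_unitLog_eq_one`, `norm_iterate_unitLog_one_add_pi_eq_one`);
* `caseA_or_caseB` — by the gap hypothesis exactly one of (a), (b) holds.

So at `(p, e, f) = (p, p, 1)` BOTH behaviours occur: whether a unit can survive two (equivalently, by (b),
arbitrarily many) logarithms depends on the class of `πᵖ/p + π` modulo `π²`, not on the ramification
invariants.  Consumer: `Literature/IUT/LogThetaLattice/LogLinkIteratesDepthThree.lean` (domains `D_n` of the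
log-link iterates, [IUTchIII] Rmk 1.1.1 (i): (a) ⇒ `D_3 = ∅ ≠ D_2`, (b) ⇒ `D_n ≠ ∅` for all `n`).  Classical
`p`-adic analysis (Neukirch, *Algebraic Number Theory*, Ch. II (5.5)); nothing here is disputed mathematics; no
IUT statement is asserted; nothing bears on [IUTchIII] Cor. 3.12.
-/

noncomputable section

open Metric Set Finset
open scoped NormedField

namespace Literature.IUT.LogVolume

namespace DepthThree

open Literature.IUT.LogThetaLattice
open Literature.NumberTheory.EllipticCurves (norm_pow_sub_pow_le)

variable {p : ℕ} [hp : Fact p.Prime]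
variable {K : Type*} [NontriviallyNormedField K] [instK : NormedAlgebra ℚ_[p] K] [IsUltrametricDist K]
variable {π : K}
variable [CompleteSpace K]

/-! ### §1. Depth `2` is inhabited: `1 + π` -/

omit [CompleteSpace K] in
/-- `‖(1 + π)^{p−1} − 1‖ = ‖π‖` (`(1 + π)^{p−1} − 1 = π·Σ_{i<p−1}(1 + π)ⁱ` and the sum is `≡ p − 1`, a unit).
[cite: NeukirchANT1999, Ch. II (5.5)] -/
theorem norm_one_add_pi_pow_sub_one_eq (hπ : ‖π‖ ^ p = (p : ℝ)⁻¹) :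
    ‖(1 + π) ^ (p - 1) - 1‖ = ‖π‖ := by
  have hr1 : ‖π‖ < 1 := norm_pi_lt_one hπ
  have hnd : ¬ p ∣ p - 1 := not_prime_dvd_sub_one
  set S : K := ∑ i ∈ range (p - 1), (1 + π) ^ i with hS
  have hgeom : (1 + π) ^ (p - 1) - 1 = S * π := by
    have := geom_sum_mul (1 + π) (p - 1)
    rw [show (1 : K) + π - 1 = π by ring] at this
    rw [← this]
  have hSsub : S - ((p - 1 : ℕ) : K) = ∑ i ∈ range (p - 1), ((1 + π) ^ i - 1) := by
    rw [hS, sum_sub_distrib, sum_const, card_range, nsmul_eq_mul, mul_one]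
  have hterm : ∀ i ∈ range (p - 1), ‖(1 + π) ^ i - 1‖ ≤ ‖π‖ := by
    intro i _
    have h1π : ‖1 + π‖ ≤ 1 := by
      refine (IsUltrametricDist.norm_add_le_max _ _).trans (max_le (by rw [norm_one]) hr1.le)
    have := norm_pow_sub_pow_le h1π (by rw [norm_one]) i
    rwa [one_pow, show (1 : K) + π - 1 = π by ring] at this
  have hSn : ‖S - ((p - 1 : ℕ) : K)‖ ≤ ‖π‖ := by
    rw [hSsub]
    exact IsUltrametricDist.norm_sum_le_of_forall_le_of_nonneg (norm_nonneg π) hterm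
  have hp1n : ‖((p - 1 : ℕ) : K)‖ = 1 := norm_natCast_eq_one_of_not_dvd p hnd
  have hlt : ‖S - ((p - 1 : ℕ) : K)‖ < ‖((p - 1 : ℕ) : K)‖ := by rw [hp1n]; exact hSn.trans_lt hr1
  have hS1 : ‖S‖ = 1 := by
    rw [show S = ((p - 1 : ℕ) : K) + (S - ((p - 1 : ℕ) : K)) by ring,
      IsUltrametricDist.norm_add_eq_max_of_norm_ne_norm (ne_of_gt hlt), max_eq_left hlt.le, hp1n]
  rw [hgeom, norm_mul, hS1, one_mul]

/-- `‖log_p(1 + π)‖ = 1`. [cite: NeukirchANT1999, Ch. II (5.5)] -/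
theorem norm_unitLog_one_add_pi_eq_one (hp2 : p ≠ 2) (hπ : ‖π‖ ^ p = (p : ℝ)⁻¹)
    (hgap : ∀ x : K, ‖x‖ < 1 → ‖x‖ ≤ ‖π‖) (hfrob : ∀ t : K, ‖t‖ ≤ 1 → ‖t ^ p - t‖ < 1) :
    ‖unitLog (1 + π)‖ = 1 := by
  have h1 : ‖(1 : K) + π‖ = 1 := by
    have hlt : ‖π‖ < ‖(1 : K)‖ := by rw [norm_one]; exact norm_pi_lt_one hπ
    rw [IsUltrametricDist.norm_add_eq_max_of_norm_ne_norm (ne_of_gt hlt), max_eq_left hlt.le, norm_one]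
  exact norm_unitLog_eq_one_of_norm_pow_sub_one_eq hp2 hπ hgap hfrob h1 (norm_one_add_pi_pow_sub_one_eq hπ)

/-! ### §2. The second logarithm: `(log_p u)^{p−1} ≡ w^{p−1} (mod π²)` -/

omit [CompleteSpace K] in
/-- `(t^{p−1})ᵖ ≡ 1 (mod π²)` for a unit `t` (`t^{p−1} = 1 + s`, `‖s‖ ≤ ‖π‖`, Frobenius congruence
`‖(1 + s)ᵖ − 1‖ ≤ max (‖p‖‖s‖) (‖s‖ᵖ)`). [cite: NeukirchANT1999, Ch. II (5.5)] -/
theorem norm_pow_pow_sub_one_le_sq (hπ : ‖π‖ ^ p = (p : ℝ)⁻¹) (hgap : ∀ x : K, ‖x‖ < 1 → ‖x‖ ≤ ‖π‖)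
    (hfrob : ∀ t : K, ‖t‖ ≤ 1 → ‖t ^ p - t‖ < 1) {t : K} (ht : ‖t‖ = 1) :
    ‖(t ^ (p - 1)) ^ p - 1‖ ≤ ‖π‖ ^ 2 := by
  have hπ1 : ‖π‖ ≤ 1 := (norm_pi_lt_one hπ).le
  set s : K := t ^ (p - 1) - 1 with hs
  have hsn : ‖s‖ ≤ ‖π‖ := norm_pow_sub_one_le hgap hfrob ht
  have hs1 : ‖s‖ ≤ 1 := hsn.trans hπ1
  rw [show t ^ (p - 1) = 1 + s by rw [hs]; ring]
  refine (norm_one_add_pow_prime_sub_one_le hs1).trans (max_le ?_ ?_)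
  · calc ‖(p : K)‖ * ‖s‖ ≤ ‖π‖ ^ 2 * 1 :=
          mul_le_mul (norm_prime_le_sq hπ) hs1 (norm_nonneg _) (sq_nonneg _)
      _ = ‖π‖ ^ 2 := mul_one _
  · calc ‖s‖ ^ p ≤ ‖π‖ ^ p := pow_le_pow_left₀ (norm_nonneg _) hsn _
      _ ≤ ‖π‖ ^ 2 := pow_le_pow_of_le_one (norm_nonneg _) hπ1 hp.out.two_le

omit [CompleteSpace K] in
/-- The main term raised to the `(p−1)`-st power: **`(c·tᵖ·w)^{p−1} ≡ w^{p−1} (mod π²)`** for a unit `t`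
(`c ≡ −1 (mod p)`, `p − 1` even, `(t^{p−1})ᵖ ≡ 1`). [cite: NeukirchANT1999, Ch. II (5.5)] -/
theorem norm_main_pow_sub_pow_le_sq (hp2 : p ≠ 2) (hπ : ‖π‖ ^ p = (p : ℝ)⁻¹)
    (hgap : ∀ x : K, ‖x‖ < 1 → ‖x‖ ≤ ‖π‖) (hfrob : ∀ t : K, ‖t‖ ≤ 1 → ‖t ^ p - t‖ < 1) {t w : K}
    (ht : ‖t‖ = 1) (hw : ‖w‖ = 1) :
    ‖((((p - 1 : ℕ) : K))⁻¹ * t ^ p * w) ^ (p - 1) - w ^ (p - 1)‖ ≤ ‖π‖ ^ 2 := by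
  have heven : Even (p - 1) := Nat.Odd.sub_odd (hp.out.odd_of_ne_two hp2) odd_one
  set c : K := (((p - 1 : ℕ) : K))⁻¹ with hc
  have hcn : ‖c‖ = 1 := norm_c_eq_one
  have htp : ‖t ^ p‖ = 1 := by rw [norm_pow, ht, one_pow]
  -- step 1: `c t^p w ≡ -(t^p w)`
  have hA : ‖(c * t ^ p * w) ^ (p - 1) - (-(t ^ p * w)) ^ (p - 1)‖ ≤ ‖π‖ ^ 2 := by
    refine (norm_pow_sub_pow_le (by rw [norm_mul, norm_mul, hcn, htp, hw]; norm_num)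
      (by rw [norm_neg, norm_mul, htp, hw]; norm_num) _).trans ?_
    rw [show c * t ^ p * w - -(t ^ p * w) = (c + 1) * (t ^ p * w) by ring, norm_mul, norm_mul, htp, hw,
      mul_one, mul_one, hc, norm_c_add_one]
    exact norm_prime_le_sq hπ
  -- step 2: `(-(t^p w))^(p-1) = (t^(p-1))^p * w^(p-1) ≡ w^(p-1)`
  have hB : (-(t ^ p * w)) ^ (p - 1) = (t ^ (p - 1)) ^ p * w ^ (p - 1) := by
    rw [heven.neg_pow, mul_pow, ← pow_mul, ← pow_mul, mul_comm p]
  have hC : ‖(t ^ (p - 1)) ^ p * w ^ (p - 1) - w ^ (p - 1)‖ ≤ ‖π‖ ^ 2 := by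
    rw [show (t ^ (p - 1)) ^ p * w ^ (p - 1) - w ^ (p - 1) = ((t ^ (p - 1)) ^ p - 1) * w ^ (p - 1) by ring,
      norm_mul, norm_pow, hw, one_pow, mul_one]
    exact norm_pow_pow_sub_one_le_sq hπ hgap hfrob ht
  have hsplit : (c * t ^ p * w) ^ (p - 1) - w ^ (p - 1) =
      ((c * t ^ p * w) ^ (p - 1) - (-(t ^ p * w)) ^ (p - 1)) +
        ((t ^ (p - 1)) ^ p * w ^ (p - 1) - w ^ (p - 1)) := by rw [← hB]; ring
  rw [hsplit]
  exact (IsUltrametricDist.norm_add_le_max _ _).trans (max_le hA hC)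

/-- **`(log_p u)^{p−1} ≡ (πᵖ/p + π)^{p−1} (mod π²)`** for every unit `u` with `‖u^{p−1} − 1‖ = ‖π‖` (in
particular for every unit whose logarithm is a unit). [cite: NeukirchANT1999, Ch. II (5.5)] -/
theorem norm_pow_unitLog_sub_pow_le_sq (hp2 : p ≠ 2) (hπ : ‖π‖ ^ p = (p : ℝ)⁻¹)
    (hgap : ∀ x : K, ‖x‖ < 1 → ‖x‖ ≤ ‖π‖) (hfrob : ∀ t : K, ‖t‖ ≤ 1 → ‖t ^ p - t‖ < 1) {u : K}
    (hu : ‖u‖ = 1) (hux : ‖u ^ (p - 1) - 1‖ = ‖π‖) :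
    ‖(unitLog u) ^ (p - 1) - (π ^ p / (p : K) + π) ^ (p - 1)‖ ≤ ‖π‖ ^ 2 := by
  have hr0 : 0 < ‖π‖ := norm_pi_pos hπ
  set t : K := (u ^ (p - 1) - 1) / π with htdef
  set w : K := π ^ p / (p : K) + π with hwdef
  have htn : ‖t‖ = 1 := by rw [htdef, norm_div, hux, div_self hr0.ne']
  have hwn : ‖w‖ = 1 := norm_w_eq_one hπ
  set M : K := (((p - 1 : ℕ) : K))⁻¹ * t ^ p * w with hM
  have hMn : ‖M‖ = 1 := by
    rw [hM, norm_mul, norm_mul, norm_c_eq_one, norm_pow, htn, one_pow, hwn]; ring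
  have h1 : ‖unitLog u - M‖ ≤ ‖π‖ ^ 2 := norm_unitLog_sub_main_le_sq hp2 hπ hgap hfrob hu
  have hlog1 : ‖unitLog u‖ ≤ 1 := by
    rw [show unitLog u = M + (unitLog u - M) by ring]
    refine (IsUltrametricDist.norm_add_le_max _ _).trans (max_le hMn.le (h1.trans ?_))
    exact ((sq_lt_norm_pi hπ).trans (norm_pi_lt_one hπ)).le
  have h2 : ‖(unitLog u) ^ (p - 1) - M ^ (p - 1)‖ ≤ ‖π‖ ^ 2 :=
    (norm_pow_sub_pow_le hlog1 hMn.le _).trans h1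
  have h3 : ‖M ^ (p - 1) - w ^ (p - 1)‖ ≤ ‖π‖ ^ 2 := norm_main_pow_sub_pow_le_sq hp2 hπ hgap hfrob htn hwn
  rw [show (unitLog u) ^ (p - 1) - w ^ (p - 1) =
      ((unitLog u) ^ (p - 1) - M ^ (p - 1)) + (M ^ (p - 1) - w ^ (p - 1)) by ring]
  exact (IsUltrametricDist.norm_add_le_max _ _).trans (max_le h2 h3)

/-! ### §3. CASE (a): `(πᵖ/p + π)^{p−1} ≡ 1 (mod π²)` — no unit survives two logarithms -/

/-- **CASE (a).** If `‖(πᵖ/p + π)^{p−1} − 1‖ ≤ ‖π‖²` (e.g. `πᵖ = p·(1 − π)`, where `πᵖ/p + π = 1`), then for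
EVERY unit `u` with `‖log_p u‖ = 1` the second logarithm is NOT a unit: `‖log_p(log_p u)‖ ≤ ‖π‖² < 1`.
[cite: NeukirchANT1999, Ch. II (5.5)] -/
theorem norm_unitLog_unitLog_le_sq (hp2 : p ≠ 2) (hπ : ‖π‖ ^ p = (p : ℝ)⁻¹)
    (hgap : ∀ x : K, ‖x‖ < 1 → ‖x‖ ≤ ‖π‖) (hfrob : ∀ t : K, ‖t‖ ≤ 1 → ‖t ^ p - t‖ < 1)
    (ha : ‖(π ^ p / (p : K) + π) ^ (p - 1) - 1‖ ≤ ‖π‖ ^ 2) {u : K} (hu : ‖u‖ = 1)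
    (hlog : ‖unitLog u‖ = 1) : ‖unitLog (unitLog u)‖ ≤ ‖π‖ ^ 2 := by
  have hux : ‖u ^ (p - 1) - 1‖ = ‖π‖ := norm_pow_sub_one_eq_of_norm_unitLog_eq_one hπ hgap hfrob hu hlog
  have h1 := norm_pow_unitLog_sub_pow_le_sq hp2 hπ hgap hfrob hu hux
  have h2 : ‖(unitLog u) ^ (p - 1) - 1‖ ≤ ‖π‖ ^ 2 := by
    rw [show (unitLog u) ^ (p - 1) - 1 = ((unitLog u) ^ (p - 1) - (π ^ p / (p : K) + π) ^ (p - 1)) +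
        ((π ^ p / (p : K) + π) ^ (p - 1) - 1) by ring]
    exact (IsUltrametricDist.norm_add_le_max _ _).trans (max_le h1 ha)
  exact norm_unitLog_le_sq hπ hfrob hlog h2

/-- **CASE (a), headline: no unit of `K` has both `log_p u` and `log_p(log_p u)` units.**
[cite: NeukirchANT1999, Ch. II (5.5)] -/
theorem norm_unitLog_unitLog_lt_one (hp2 : p ≠ 2) (hπ : ‖π‖ ^ p = (p : ℝ)⁻¹)
    (hgap : ∀ x : K, ‖x‖ < 1 → ‖x‖ ≤ ‖π‖) (hfrob : ∀ t : K, ‖t‖ ≤ 1 → ‖t ^ p - t‖ < 1)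
    (ha : ‖(π ^ p / (p : K) + π) ^ (p - 1) - 1‖ ≤ ‖π‖ ^ 2) {u : K} (hu : ‖u‖ = 1)
    (hlog : ‖unitLog u‖ = 1) : ‖unitLog (unitLog u)‖ < 1 :=
  (norm_unitLog_unitLog_le_sq hp2 hπ hgap hfrob ha hu hlog).trans_lt
    ((sq_lt_norm_pi hπ).trans (norm_pi_lt_one hπ))

/-- CASE (a), set form: `{u : ‖u‖ = 1 ∧ ‖log_p u‖ = 1 ∧ ‖log_p (log_p u)‖ = 1} = ∅`.
[cite: NeukirchANT1999, Ch. II (5.5)] -/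
theorem setOf_two_steps_eq_empty (hp2 : p ≠ 2) (hπ : ‖π‖ ^ p = (p : ℝ)⁻¹)
    (hgap : ∀ x : K, ‖x‖ < 1 → ‖x‖ ≤ ‖π‖) (hfrob : ∀ t : K, ‖t‖ ≤ 1 → ‖t ^ p - t‖ < 1)
    (ha : ‖(π ^ p / (p : K) + π) ^ (p - 1) - 1‖ ≤ ‖π‖ ^ 2) :
    {u : K | ‖u‖ = 1 ∧ ‖unitLog u‖ = 1 ∧ ‖unitLog (unitLog u)‖ = 1} = ∅ := by
  ext u
  simp only [mem_setOf_eq, mem_empty_iff_false, iff_false, not_and]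
  intro hu h1 h2
  have := norm_unitLog_unitLog_lt_one hp2 hπ hgap hfrob ha hu h1
  rw [h2] at this
  exact lt_irrefl _ this

omit [CompleteSpace K] in
/-- The hypothesis of CASE (a) from a congruence `πᵖ/p + π ≡ a (mod π²)` with `a ∈ ℕ` (a Teichmüller
representative modulo `π²`, as `f = 1` and `a^{p−1} ≡ 1 (mod p)`): then `‖(πᵖ/p + π)^{p−1} − 1‖ ≤ ‖π‖²`.
[cite: NeukirchANT1999, Ch. II (5.5)] -/
theorem caseA_of_norm_sub_natCast_le (hπ : ‖π‖ ^ p = (p : ℝ)⁻¹) {a : ℕ}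
    (h : ‖π ^ p / (p : K) + π - (a : K)‖ ≤ ‖π‖ ^ 2) :
    ‖(π ^ p / (p : K) + π) ^ (p - 1) - 1‖ ≤ ‖π‖ ^ 2 := by
  set w : K := π ^ p / (p : K) + π with hw
  have hwn : ‖w‖ = 1 := norm_w_eq_one hπ
  have hlt1 : ‖π‖ ^ 2 < 1 := (sq_lt_norm_pi hπ).trans (norm_pi_lt_one hπ)
  -- `a` is a unit of `ℤ_p`: `‖a‖ = 1`
  have han : ‖(a : K)‖ = 1 := by
    have hlt : ‖(a : K) - w‖ < ‖w‖ := by rw [hwn, norm_sub_rev]; exact h.trans_lt hlt1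
    rw [show (a : K) = w + ((a : K) - w) by ring,
      IsUltrametricDist.norm_add_eq_max_of_norm_ne_norm (ne_of_gt hlt), max_eq_left hlt.le, hwn]
  have hpa : ¬ p ∣ a := by
    intro hdvd
    have : ‖(a : K)‖ < 1 := by
      rw [norm_natCast_eq_padicNorm p K a]
      exact Padic.norm_natCast_lt_one_iff.mpr hdvd
    rw [han] at this
    exact lt_irrefl _ this
  -- Fermat: `a^(p-1) ≡ 1 (mod p)`
  have hferm : ‖((a : K)) ^ (p - 1) - 1‖ ≤ ‖(p : K)‖ := by
    have ha0 : (a : ZMod p) ≠ 0 := fun h0 ↦ hpa ((ZMod.natCast_eq_zero_iff a p).mp h0)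
    have hmod : (a : ZMod p) ^ (p - 1) = 1 := ZMod.pow_card_sub_one_eq_one ha0
    have hdvd : (p : ℤ) ∣ (a : ℤ) ^ (p - 1) - 1 := by
      rw [← ZMod.intCast_zmod_eq_zero_iff_dvd]
      push_cast
      rw [hmod, sub_self]
    obtain ⟨m, hm⟩ := hdvd
    have hcast : ((a : K)) ^ (p - 1) - 1 = (p : K) * (m : K) := by
      have := congrArg (Int.cast : ℤ → K) hm
      push_cast at this
      exact this
    have hmn : ‖(m : K)‖ ≤ 1 := by
      rw [← map_intCast (algebraMap ℚ_[p] K) m, norm_algebraMap']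
      exact Padic.norm_int_le_one m
    rw [hcast, norm_mul]
    calc ‖(p : K)‖ * ‖(m : K)‖ ≤ ‖(p : K)‖ * 1 := by gcongr
      _ = ‖(p : K)‖ := mul_one _
  have h1 : ‖w ^ (p - 1) - ((a : K)) ^ (p - 1)‖ ≤ ‖π‖ ^ 2 :=
    (norm_pow_sub_pow_le hwn.le han.le _).trans h
  rw [show w ^ (p - 1) - 1 = (w ^ (p - 1) - ((a : K)) ^ (p - 1)) + (((a : K)) ^ (p - 1) - 1) by ring]
  exact (IsUltrametricDist.norm_add_le_max _ _).trans
    (max_le h1 (hferm.trans (norm_prime_le_sq hπ)))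

/-! ### §4. CASE (b): `‖(πᵖ/p + π)^{p−1} − 1‖ > ‖π‖²` — the good units are `log_p`-stable -/

/-- **CASE (b).** If `‖π‖² < ‖(πᵖ/p + π)^{p−1} − 1‖` (e.g. `πᵖ = p`), then for every unit `u` with
`‖u^{p−1} − 1‖ = ‖π‖` the logarithm `log_p u` is again a unit with `‖(log_p u)^{p−1} − 1‖ = ‖π‖`: the set of
such units is mapped into itself by `log_p`. [cite: NeukirchANT1999, Ch. II (5.5)] -/
theorem norm_pow_unitLog_sub_one_eq (hp2 : p ≠ 2) (hπ : ‖π‖ ^ p = (p : ℝ)⁻¹)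
    (hgap : ∀ x : K, ‖x‖ < 1 → ‖x‖ ≤ ‖π‖) (hfrob : ∀ t : K, ‖t‖ ≤ 1 → ‖t ^ p - t‖ < 1)
    (hb : ‖π‖ ^ 2 < ‖(π ^ p / (p : K) + π) ^ (p - 1) - 1‖) {u : K} (hu : ‖u‖ = 1)
    (hux : ‖u ^ (p - 1) - 1‖ = ‖π‖) :
    ‖unitLog u‖ = 1 ∧ ‖(unitLog u) ^ (p - 1) - 1‖ = ‖π‖ := by
  refine ⟨norm_unitLog_eq_one_of_norm_pow_sub_one_eq hp2 hπ hgap hfrob hu hux, ?_⟩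
  set w : K := π ^ p / (p : K) + π with hw
  have hwn : ‖w‖ = 1 := norm_w_eq_one hπ
  have hw1 : ‖w ^ (p - 1) - 1‖ = ‖π‖ := by
    rcases norm_eq_or_le_sq hπ hgap (norm_pow_sub_one_lt_one hfrob hwn) with h | h
    · exact h
    · exact absurd h (not_le.mpr hb)
  have h1 := norm_pow_unitLog_sub_pow_le_sq hp2 hπ hgap hfrob hu hux
  have hlt : ‖(unitLog u) ^ (p - 1) - w ^ (p - 1)‖ < ‖w ^ (p - 1) - 1‖ := by
    rw [hw1]; exact h1.trans_lt (sq_lt_norm_pi hπ)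
  rw [show (unitLog u) ^ (p - 1) - 1 = ((unitLog u) ^ (p - 1) - w ^ (p - 1)) + (w ^ (p - 1) - 1) by ring,
    IsUltrametricDist.norm_add_eq_max_of_norm_ne_norm (ne_of_lt hlt), max_eq_right hlt.le, hw1]

/-- CASE (b), iterated: every iterate `log_p^{[n]} u` of such a unit is a unit with the same property.
[cite: NeukirchANT1999, Ch. II (5.5)] -/
theorem norm_iterate_unitLog_eq_one (hp2 : p ≠ 2) (hπ : ‖π‖ ^ p = (p : ℝ)⁻¹)
    (hgap : ∀ x : K, ‖x‖ < 1 → ‖x‖ ≤ ‖π‖) (hfrob : ∀ t : K, ‖t‖ ≤ 1 → ‖t ^ p - t‖ < 1)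
    (hb : ‖π‖ ^ 2 < ‖(π ^ p / (p : K) + π) ^ (p - 1) - 1‖) {u : K} (hu : ‖u‖ = 1)
    (hux : ‖u ^ (p - 1) - 1‖ = ‖π‖) (n : ℕ) :
    ‖unitLog^[n] u‖ = 1 ∧ ‖(unitLog^[n] u) ^ (p - 1) - 1‖ = ‖π‖ := by
  induction n with
  | zero => exact ⟨hu, hux⟩
  | succ n ih =>
    rw [Function.iterate_succ_apply']
    exact norm_pow_unitLog_sub_one_eq hp2 hπ hgap hfrob hb ih.1 ih.2

/-- CASE (b): **every iterated logarithm of `1 + π` is a unit.** [cite: NeukirchANT1999, Ch. II (5.5)] -/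
theorem norm_iterate_unitLog_one_add_pi_eq_one (hp2 : p ≠ 2) (hπ : ‖π‖ ^ p = (p : ℝ)⁻¹)
    (hgap : ∀ x : K, ‖x‖ < 1 → ‖x‖ ≤ ‖π‖) (hfrob : ∀ t : K, ‖t‖ ≤ 1 → ‖t ^ p - t‖ < 1)
    (hb : ‖π‖ ^ 2 < ‖(π ^ p / (p : K) + π) ^ (p - 1) - 1‖) (n : ℕ) :
    ‖unitLog^[n] (1 + π)‖ = 1 := by
  have h1 : ‖(1 : K) + π‖ = 1 := by
    have hlt : ‖π‖ < ‖(1 : K)‖ := by rw [norm_one]; exact norm_pi_lt_one hπ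
    rw [IsUltrametricDist.norm_add_eq_max_of_norm_ne_norm (ne_of_gt hlt), max_eq_left hlt.le, norm_one]
  exact (norm_iterate_unitLog_eq_one hp2 hπ hgap hfrob hb h1 (norm_one_add_pi_pow_sub_one_eq hπ) n).1

/-! ### §5. Exactly one of the two cases holds -/

omit [CompleteSpace K] in
/-- **DICHOTOMY**: by the gap hypothesis `‖(πᵖ/p + π)^{p−1} − 1‖` is either `≤ ‖π‖²` (CASE (a)) or `= ‖π‖ > ‖π‖²`
(CASE (b)). [cite: NeukirchANT1999, Ch. II (5.5)] -/
theorem caseA_or_caseB (hπ : ‖π‖ ^ p = (p : ℝ)⁻¹) (hgap : ∀ x : K, ‖x‖ < 1 → ‖x‖ ≤ ‖π‖)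
    (hfrob : ∀ t : K, ‖t‖ ≤ 1 → ‖t ^ p - t‖ < 1) :
    ‖(π ^ p / (p : K) + π) ^ (p - 1) - 1‖ ≤ ‖π‖ ^ 2 ∨
      ‖π‖ ^ 2 < ‖(π ^ p / (p : K) + π) ^ (p - 1) - 1‖ := by
  rcases norm_eq_or_le_sq hπ hgap (norm_pow_sub_one_lt_one hfrob (norm_w_eq_one hπ)) with h | h
  · exact Or.inr (by rw [h]; exact sq_lt_norm_pi hπ)
  · exact Or.inl h

omit [CompleteSpace K] in
/-- The example of CASE (a): **`πᵖ = p·(1 − π)`** (a root of the Eisenstein polynomial `Xᵖ + pX − p`) gives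
`πᵖ/p + π = 1`, so `‖(πᵖ/p + π)^{p−1} − 1‖ = 0 ≤ ‖π‖²`, and `‖π‖ᵖ = p⁻¹`. [cite: NeukirchANT1999, Ch. II (5.5)] -/
theorem caseA_of_pow_eq (hπp : π ^ p = (p : K) * (1 - π)) :
    ‖π‖ ^ p = (p : ℝ)⁻¹ ∧ ‖(π ^ p / (p : K) + π) ^ (p - 1) - 1‖ ≤ ‖π‖ ^ 2 := by
  have hp0 : (p : K) ≠ 0 := prime_ne_zero p K
  have hw : π ^ p / (p : K) + π = 1 := by rw [hπp, mul_div_cancel_left₀ _ hp0]; ring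
  refine ⟨?_, by rw [hw, one_pow, sub_self, norm_zero]; exact sq_nonneg _⟩
  -- `‖π‖ < 1`: otherwise `‖π‖^p = ‖p‖ ‖1 - π‖ ≤ p⁻¹ max 1 ‖π‖ < ‖π‖ ≤ ‖π‖^p`
  have hpn : ‖(p : K)‖ < 1 := norm_prime_lt_one p K
  have hπ1 : ‖π‖ < 1 := by
    by_contra hge
    rw [not_lt] at hge
    have h1 : ‖π‖ ^ p = ‖(p : K)‖ * ‖1 - π‖ := by rw [← norm_pow, hπp, norm_mul]
    have h2 : ‖(1 : K) - π‖ ≤ ‖π‖ := by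
      rw [sub_eq_add_neg]
      exact (IsUltrametricDist.norm_add_le_max _ _).trans
        (max_le (by rw [norm_one]; exact hge) (by rw [norm_neg]))
    have h3 : ‖π‖ ^ p < ‖π‖ := by
      rw [h1]
      calc ‖(p : K)‖ * ‖1 - π‖ ≤ ‖(p : K)‖ * ‖π‖ := by gcongr
        _ < 1 * ‖π‖ := by gcongr
        _ = ‖π‖ := one_mul _
    have h4 : ‖π‖ ≤ ‖π‖ ^ p := by
      calc ‖π‖ = ‖π‖ ^ 1 := (pow_one _).symm
        _ ≤ ‖π‖ ^ p := pow_le_pow_right₀ hge hp.out.one_le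
    exact absurd (h4.trans_lt h3) (lt_irrefl _)
  have h1π : ‖(1 : K) - π‖ = 1 := by
    have hlt : ‖-π‖ < ‖(1 : K)‖ := by rw [norm_one, norm_neg]; exact hπ1
    rw [sub_eq_add_neg, IsUltrametricDist.norm_add_eq_max_of_norm_ne_norm (ne_of_gt hlt),
      max_eq_left hlt.le, norm_one]
  rw [← norm_pow, hπp, norm_mul, h1π, mul_one, norm_prime p K]

omit [CompleteSpace K] in
/-- The example of CASE (b): **`πᵖ = p`** gives `πᵖ/p + π = 1 + π`, `‖(1 + π)^{p−1} − 1‖ = ‖π‖ > ‖π‖²`.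
[cite: NeukirchANT1999, Ch. II (5.5)] -/
theorem caseB_of_pow_eq (hπp : π ^ p = (p : K)) :
    ‖π‖ ^ p = (p : ℝ)⁻¹ ∧ ‖π‖ ^ 2 < ‖(π ^ p / (p : K) + π) ^ (p - 1) - 1‖ := by
  have hp0 : (p : K) ≠ 0 := prime_ne_zero p K
  have hπ : ‖π‖ ^ p = (p : ℝ)⁻¹ := WildPrime.norm_pi_pow hπp
  refine ⟨hπ, ?_⟩
  rw [hπp, div_self hp0, norm_one_add_pi_pow_sub_one_eq hπ]
  exact sq_lt_norm_pi hπ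

end DepthThree

end Literature.IUT.LogVolume

end
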